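import Literature.IUT.HodgeArakelov.ThetaEvaluationSettingModelProofs
import Literature.IUT.HodgeArakelov.ThetaEvaluationSettingAtModelTateOfExtends
import HarnessLib

/-!
# [IUTchII] Prop. 2.2 (i)′ at the [EtTh] stage-2 Tate models `modelχq p i 2` with the (H1) binder F-2633 `PiYddCharacteristic C`
# SUPPLIED from the extension property hextΔ ALONE — the F-2633 site of K4 row IUTchII:Prop2.2(i) (proof-only; one term)

S. Mochizuki, *Inter-universal Teichmüller theory II*, kurims manuscript (Dec. 2020), §2 Prop. 2.2 (i) pp. 66–67
[claim: Mochizuki2012, status: disputed] (IUTchII §2 Prop 2.2 (i), kurims pp.66-67); §1 Prop. 1.4 p. 27 l. 13–14 («the open subgroup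
`Π_Ÿ(Π) ⊆ Π` corresponding to the tempered covering “`Ÿ`”» — the (H1) clause typed as abc-iut-L6-t1's `EtaleThetaDataOfSetting.PiYddCharacteristic`, FACT-LIST F-2633)
[claim: Mochizuki2012, status: disputed] (IUTchII §1 Prop 1.4, kurims p.27); S. Mochizuki, *The étale theta function …* [EtTh],
Publ. RIMS **45** (2009), Prop. 2.4 (i) p. 38 (every automorphism of `Π^tp_{X̲̲}` extends to `Π^tp_X`) [cite: MochizukiEtTh2009, Prop 2.4 (i) p.38].

abc-iut cell, seat abc-iut-c312-2 (gen 8), director-abc KEY row «K4R9» (C-R33 K4 RE-CLOSE of the RECLOSABLE class of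
`CONE-K4-RECLOSE.tsv`): cone node IUTchII:Prop2.2(i).  PROOF-ONLY: no definition, no instance, no notation, no `Prop` fact;
nothing of another seat is edited or restated — inputs are consumed BY NAME.

DOC v2 (2026-08-27T10:2xZ, referee lane LETTER 3 (b) micro-OBS): the Prop. 1.4 quotation completed with print's appositive «the tempered
covering»; statement and proof byte-identical to v1 (p512343).

STATE OF RECORD BEFORE THIS FILE.  The K4 row IUTchII:Prop2.2(i) binds two refuted-closure FACT rows: F-2595 `Cor23iii` at the
closers `prop22_i'_of_cor23iii(_bridge)` — RE-CLOSED by abc-iut-w5-d162 g7 via the outer route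
(`ModelTateCarriers.prop22_i'_genuineEnv_of_outer_modelTate`, p464147, `K4-L6-IUTchII-INSTANCES.tsv`) — and F-2633
`PiYddCharacteristic C` = binder `hchar` of abc-iut-L6-t1's closer `prop22_i'_etaleThetaDataOfSetting`
(`ThetaEvaluationSettingModelProofs`), whose `∀`-closure over all `X̲̲`-choices is REFUTED in the tree (abc-iut-L6-t19
`not_forall_piYddCharacteristic`).  abc-iut-w5-d169 (gen 10) landed `SettingModel.piYddCharacteristic_modelχq_of_extends`
(p492265, `ThetaEvaluationSettingAtModelTateOfExtends`): (H1) at EVERY étale-theta datum over `modelχq p i 2` and EVERY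
`X̲̲`-choice ⟸ the DISPLAYED binder hextΔ («every bi-continuous automorphism of `Π^tp_{X̲̲}` extends to a `Δ^tp_X`-stabilising
bi-continuous automorphism of `Π^tp_X`», the [EtTh] Prop. 2.4 (i) shape; UNDECIDED at the semi-synthetic model) ALONE, and used it
for the Prop. 2.2 (ii)′ closers; the Prop. 2.2 (i)′ closer was not re-keyed.

THIS FILE (one term, nothing new in mathematics): `prop22_i'_etaleThetaDataOfSetting_modelχq_of_extends` — abc-iut-L6-t1's
Prop. 2.2 (i)′ closer at every étale-theta datum `E` over `modelχq p i 2` (every prime `p`, every `i`) and every `X̲̲`-choice `C`,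
with `hchar := piYddCharacteristic_modelχq_of_extends p i C hextΔ`; the remaining binders are the closer's own [IUTchII]-side data
(`S`, `eS`, `hl`, `R`, `T`, `G`, `ι₀`) and hypotheses `hG : R.GroupTheoretic` (F-1782, predicate class) and `hsurj` (the vertex-`0`
decomposition group surjects — an ∃-clause over the data, not a FACT row).  RESIDUAL OF RECORD for the F-2633 site of K4 row
IUTchII:Prop2.2(i) at the models: {hextΔ} — displayed, CONDITIONAL-AT-MODEL.

HONEST FRAMING: `modelχq` is a SEMI-SYNTHETIC model of the typed [EtTh] §1 interface (not the tempered `π₁` of a curve) —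
binder-discharge evidence for OUR typed rows only; F-2633 stays a FACT-policy row (assumption label by ID); hextΔ is a DISPLAYED
binder, not asserted; nothing of [IUTchII] / [EtTh] is asserted beyond the displayed statements; no side is taken on [IUTchIII]
Cor. 3.12; typed ≠ proved; conditional-at-a-model ≠ proved in print; re-closed ≠ endorsed; nothing here says abc is proved or refuted.
-/

noncomputable section

namespace Literature.IUT.HodgeArakelov

open Literature.AnabelianGeometry.EtaleTheta Literature.AnabelianGeometry.EtaleTheta.SettingModel
open EtaleThetaDataOfSetting

variable (p : ℕ) [Fact p.Prime] (i : ℤ) {E : (ThetaSetting.modelχq p i 2 even_two).EtaleThetaData} {l : ℕ}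
  (C : E.DoubleUnderline l)
  (hextΔ : ∀ γ : ↥C.Huu ≃ₜ* ↥C.Huu, ∃ Γ : PiTpχq p i 2 ≃ₜ* PiTpχq p i 2,
    (∀ h : C.Huu, Γ (h : PiTpχq p i 2) = ((γ h : C.Huu) : PiTpχq p i 2)) ∧
      (curveχq p i 2).DeltaTemp.map Γ.toMulEquiv.toMonoidHom = (curveχq p i 2).DeltaTemp)

/-- **IUTchII:Prop2.2(i)′ at the stage-2 Tate models with (H1) SUPPLIED from hextΔ ALONE**: for every étale-theta datum `E`
over `modelχq p i 2`, every `X̲̲`-choice `C`, every compatibility/§2 witnesses `hC`, `hS`, and the [IUTchII]-side data of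
abc-iut-L6-t1's closer (`S`, `eS`, `hl`, `R`, `T`, `G`, `ι₀`) with its two hypotheses `hG : R.GroupTheoretic`, `hsurj`, the
repaired statement `Prop22_i' R T D ι₀` HOLDS for the Prop. 1.4 output `D := etaleThetaDataOfSetting' C hC hS hchar S eS hl` whose
(H1) input is `hchar := piYddCharacteristic_modelχq_of_extends p i C hextΔ` (abc-iut-w5-d169, p492265).  One term
(`prop22_i'_etaleThetaDataOfSetting`); proves nothing new in mathematics.
[claim: Mochizuki2012, status: disputed] (IUTchII §2 Prop 2.2 (i), kurims pp.66-67) [cite: MochizukiEtTh2009, Prop 2.4 (i) p.38] -/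
theorem prop22_i'_etaleThetaDataOfSetting_modelχq_of_extends
    (hC : (ThetaSetting.modelχq p i 2 even_two).Compat) (hS : (ThetaSetting.modelχq p i 2 even_two).Sec2Hyps)
    (S : BadPlaceSetting.{0}) (eS : (Pi C) ≃ₜ* S.PiX) (hl : S.l = l)
    (R : SubgraphReference S) (T : TemperedCoverings S (Pi C)) {G : EnvOfGroup S.toThetaSetting (Pi C)}
    (ι₀ : PointedInversion G (etaleThetaDataOfSetting' C hC hS
      (piYddCharacteristic_modelχq_of_extends p i C hextΔ) S.toThetaSetting eS hl))
    (hG : R.GroupTheoretic)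
    (hsurj : ∃ e₀ : (Pi C) ≃ₜ* S.PiX, ∀ x : Pi C, ∃ b : Pi C, e₀ b ∈ R.refBullet ∧
      G.recon.projG (G.isoX b) = G.recon.projG (G.isoX x)) :
    Prop22_i' R T (etaleThetaDataOfSetting' C hC hS (piYddCharacteristic_modelχq_of_extends p i C hextΔ)
      S.toThetaSetting eS hl) ι₀ :=
  prop22_i'_etaleThetaDataOfSetting C hC hS (piYddCharacteristic_modelχq_of_extends p i C hextΔ) S eS hl R T ι₀ hG hsurj

end Literature.IUT.HodgeArakelov

end
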